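import Mathlib
import Summits.Ventures.PercRepro2.SwOutCrossGenKEDefs
import Summits.Ventures.PercRepro2.SwOutMixedArmsBaseDefs

/-!
# The cross base: the several-arms base whose dropped vertices form one component (blind cell
PercRepro2, night-4 g23, 2026-08-28; proofs/NIGHT4-G23.md §10, step (1))

The geometric side of boundary (iv): a base colouring `σ` around `h` with the junction `u`, the
u-arms `U j`, the DROPPED VERTICES `p i` (`i : X`) joined to `u` and to each other along the
cross-edge graph `G : SimpleGraph X` (every pair with `G.Adj i j` carries an edge `p i – p j`,
all parallel edges of a pair forming ONE class), their outside edges, and the far arms `F k`; at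
`σ` every edge at `h`, at `u` and every cross edge is red, the outside edges of the `p i` and the
boundary edges of the arms blue.  A POINT is `(f, s, w)`: the far-arm bits, the u-arm bits and the
edge-indexed fibre point `w : FibKE X G` of `SwOutCrossGenKEDefs`; its realisation `crossReal`
flips the classes whose coordinate is `false`.  This file: the classes, the realisation, the
structure `CrossBase` and the first consequences (no loops; which vertices the edges at `h`, `u`
and `p i` can join; the classes are pairwise disjoint).
-/

namespace Summit.Ventures.PercRepro2

namespace CrossArm

open Hull LocRows

variable {V : Type*} {E : Type*}

open scoped Classical

section Classes

variable (ends : E → Sym2 V) (h u : V) {ι X κ : Type*} (U : ι → Set V) (p : X → V)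
  (G : SimpleGraph X) (F : κ → Set V)

/-- The union of the u-arms and the far arms. -/
def armsAllX : Set V := (⋃ j, U j) ∪ ⋃ k, F k

/-- The u–`p i` edges. -/
def clsUPX (i : X) : Set E := {e | ends e = s(u, p i)}

/-- The cross edges of the pair `s`. -/
def clsCX (s : G.edgeSet) : Set E := {e | ∃ i j, s.1 = s(i, j) ∧ ends e = s(p i, p j)}

/-- The outside edges of `p i`: the edges at `p i` not going to `u` or to a dropped vertex. -/
def clsExtX (i : X) : Set E := {e | ∃ x, ends e = s(p i, x) ∧ x ≠ u ∧ ∀ j, x ≠ p j}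

/-- A point of the cube: the far-arm bits, the u-arm bits, the fibre point. -/
abbrev PtXG (ι κ : Type*) (X : Type*) (G : SimpleGraph X) := Config κ × Config ι × FibKE X G

/-- The edges flipped by a point: the classes with coordinate `false`. -/
def flipSetX (q : PtXG ι κ X G) : Set E :=
  {e | ∃ k, q.1 k = false ∧ e ∈ touches ends (F k)} ∪
    {e | ∃ j, q.2.1 j = false ∧ e ∈ touches ends (U j)} ∪
    {e | ∃ i, q.2.2.1 i = false ∧ e ∈ clsUPX ends u p i} ∪
    {e | ∃ s, q.2.2.2.1 s = false ∧ e ∈ clsCX ends p G s} ∪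
    {e | ∃ i, q.2.2.2.2 i = false ∧ e ∈ clsExtX ends u p i}

/-- The realisation of a point: the base with the flipped classes. -/
noncomputable def crossReal (σ : Config E) (q : PtXG ι κ X G) : Config E :=
  fun e => if e ∈ flipSetX ends u U p G F q then !σ e else σ e

end Classes

/-- **The cross base**: the data of the several-arms base with the dropped vertices joined along
the cross-edge graph `G`. -/
structure CrossBase (ends : E → Sym2 V) (σ : Config E) (h u : V) {ι X κ : Type*}
    (U : ι → Set V) (p : X → V) (G : SimpleGraph X) (F : κ → Set V) : Prop where
  hne_hu : h ≠ u
  hne_hp : ∀ i, h ≠ p i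
  hne_up : ∀ i, u ≠ p i
  p_inj : Function.Injective p
  h_notMem_U : ∀ j, h ∉ U j
  u_notMem_U : ∀ j, u ∉ U j
  p_notMem_U : ∀ i j, p i ∉ U j
  h_notMem_F : ∀ k, h ∉ F k
  u_notMem_F : ∀ k, u ∉ F k
  p_notMem_F : ∀ i k, p i ∉ F k
  U_disj : ∀ j j', j ≠ j' → ∀ x, x ∈ U j → x ∉ U j'
  U_disj_F : ∀ j k x, x ∈ U j → x ∉ F k
  F_disj : ∀ k k', k ≠ k' → ∀ x, x ∈ F k → x ∉ F k'
  U_nonempty : ∀ j, (U j).Nonempty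
  F_nonempty : ∀ k, (F k).Nonempty
  no_cross_UU : ∀ j j', j ≠ j' → ∀ e x y, ends e = s(x, y) → x ∈ U j → y ∈ U j' → False
  no_cross_UF : ∀ j k e x y, ends e = s(x, y) → x ∈ U j → y ∈ F k → False
  no_cross_FF : ∀ k k', k ≠ k' → ∀ e x y, ends e = s(x, y) → x ∈ F k → y ∈ F k' → False
  h_edges : ∀ e x, ends e = s(h, x) → (∃ j, x ∈ U j) ∨ ∃ k, x ∈ F k
  u_edges : ∀ e x, ends e = s(u, x) → (∃ j, x ∈ U j) ∨ ∃ i, x = p i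
  p_edges : ∀ i e x, ends e = s(p i, x) →
    x = u ∨ (∃ j, x = p j ∧ G.Adj i j) ∨
      (x ≠ h ∧ x ≠ u ∧ (∀ j, x ≠ p j) ∧ x ∉ armsAllX U F)
  u_adj_U : ∀ j, ∃ e x, ends e = s(u, x) ∧ x ∈ U j
  h_red : ∀ e x, ends e = s(h, x) → σ e = true
  u_red : ∀ e x, ends e = s(u, x) → σ e = true
  cross_red : ∀ i j e, ends e = s(p i, p j) → σ e = true
  ext_blue : ∀ i e x, ends e = s(p i, x) → x ≠ u → (∀ j, x ≠ p j) → σ e = false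
  bdry_blue : ∀ e x y, ends e = s(x, y) → x ∈ armsAllX U F → y ≠ h → y ≠ u → (∀ i, y ≠ p i) →
    y ∉ armsAllX U F → σ e = false
  U_conn : ∀ j, ∀ x ∈ U j, x ∈ cluster ends (insideConfig ends (U j ∪ {h}) σ) h
  F_conn : ∀ k, ∀ x ∈ F k, x ∈ cluster ends (insideConfig ends (F k ∪ {h}) σ) h

section Base

variable {ends : E → Sym2 V} {σ : Config E} {h u : V} {ι X κ : Type*} {U : ι → Set V}
  {p : X → V} {G : SimpleGraph X} {F : κ → Set V} (hb : CrossBase ends σ h u U p G F)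
include hb

/-- No loop at `h`. -/
lemma CrossBase.loop_h (e : E) : ends e ≠ s(h, h) := by
  intro he
  rcases hb.h_edges e h he with ⟨j, hj⟩ | ⟨k, hk⟩
  · exact hb.h_notMem_U j hj
  · exact hb.h_notMem_F k hk

/-- No loop at `u`. -/
lemma CrossBase.loop_u (e : E) : ends e ≠ s(u, u) := by
  intro he
  rcases hb.u_edges e u he with ⟨j, hj⟩ | ⟨i, hi⟩
  · exact hb.u_notMem_U j hj
  · exact hb.hne_up i hi

/-- No loop at a dropped vertex. -/
lemma CrossBase.loop_p (i : X) (e : E) : ends e ≠ s(p i, p i) := by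
  intro he
  rcases hb.p_edges i e (p i) he with hu | ⟨j, hj, hadj⟩ | ⟨-, -, hj, -⟩
  · exact hb.hne_up i hu.symm
  · exact G.irrefl (hb.p_inj hj ▸ hadj)
  · exact hj i rfl

/-- No edge joins `h` and `u`. -/
lemma CrossBase.no_hu (e : E) : ends e ≠ s(h, u) := by
  intro he
  rcases hb.h_edges e u he with ⟨j, hj⟩ | ⟨k, hk⟩
  · exact hb.u_notMem_U j hj
  · exact hb.u_notMem_F k hk

/-- No edge joins `h` and a dropped vertex. -/
lemma CrossBase.no_hp (i : X) (e : E) : ends e ≠ s(h, p i) := by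
  intro he
  rcases hb.h_edges e (p i) he with ⟨j, hj⟩ | ⟨k, hk⟩
  · exact hb.p_notMem_U i j hj
  · exact hb.p_notMem_F i k hk

/-- A cross edge joins adjacent dropped vertices. -/
lemma CrossBase.adj_of_cross {i j : X} {e : E} (he : ends e = s(p i, p j)) : G.Adj i j := by
  rcases hb.p_edges i e (p j) he with hu | ⟨j', hj', hadj⟩ | ⟨-, -, hj, -⟩
  · exact absurd hu.symm (hb.hne_up j)
  · exact hb.p_inj hj' ▸ hadj
  · exact absurd rfl (hj j)

/-- A u-arm is not joined to a dropped vertex. -/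
lemma CrossBase.no_pU {i : X} {e : E} {x : V} (he : ends e = s(p i, x)) (j : ι) : x ∉ U j := by
  intro hx
  rcases hb.p_edges i e x he with rfl | ⟨j', rfl, -⟩ | ⟨-, -, -, hx'⟩
  · exact hb.u_notMem_U j hx
  · exact hb.p_notMem_U j' j hx
  · exact hx' (Or.inl (Set.mem_iUnion.2 ⟨j, hx⟩))

/-- A far arm is not joined to a dropped vertex. -/
lemma CrossBase.no_pF {i : X} {e : E} {x : V} (he : ends e = s(p i, x)) (k : κ) : x ∉ F k := by
  intro hx
  rcases hb.p_edges i e x he with rfl | ⟨j', rfl, -⟩ | ⟨-, -, -, hx'⟩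
  · exact hb.u_notMem_F k hx
  · exact hb.p_notMem_F j' k hx
  · exact hx' (Or.inr (Set.mem_iUnion.2 ⟨k, hx⟩))

/-- A far arm is not joined to `u`. -/
lemma CrossBase.no_uF {e : E} {x : V} (he : ends e = s(u, x)) (k : κ) : x ∉ F k := by
  intro hx
  rcases hb.u_edges e x he with ⟨j, hj⟩ | ⟨i, rfl⟩
  · exact hb.U_disj_F j k x hj hx
  · exact hb.p_notMem_F i k hx

end Base

end CrossArm

end Summit.Ventures.PercRepro2
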